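import Summits.HodgeConjecture.HodgeConjecture.Cruxes.BlochSeedDiscOne.DepthBoundA4

/-!
# `Cruxes/BlochSeedDiscOne/AnchorLock.lean` — LINE 18 «ANCHOR LOCK» (plan-lens-HodgeAV-negation g17, 2026-08-30)

line stmt-HodgeConjecture-18881 Cruxes/BlochSeedDiscOne/Lines/birth.lean 814a6a70c14e831a stub_rung_pad4_seedAt

EVIDENCE LEVEL.  Nothing in this file proves HC ∕ HC_CM ∕ HC_AV ∕ H2 ∕ item 18881 ∕ Leg A `IntegralityGap.Nonex 14 199 8` ∕ any floor
`HeightTower.FloorFree h 199 8`.  The research route is conditional on HC_CM (displayed binder only); blind cells and the HC_CM packet were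
not read.  This file kernel-checks the FINITE TABLES behind the pen theorem of LINE 18 (card `Ideas/anchor-lock.md`):

> **ANCHOR LOCK (h = 6, XBASE-12 universe).**  No (A1) ∧ (A4) letter design with `μ ≠ 0`, `copies ≤ 199`, `rank ≥ 8` is supported on the
> XBASE-12 cell universe of RING6-STAGE2 (gs-eng-2 g60 `template_xbase9.json` 04ead9ae; N multisets hhhh hhhk hhhb hhzb hzbb hkbb hbbb zzzz bbbb
> over hub = (6;0,0), z = rot(4;2,0), k = rot(3;2,1) ∕ rot(3;1,2), b = rot(2;2,2); P multisets aaaa aaam mmmm over a = rot(4;1,1), m = rot(0;3,3)).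

Pen skeleton (masses: `M_z, M_b, M₄` = total N mass on zzzz, bbbb, and P mass on mmmm; `n₁, n₂` = P mass on aaaa, aaam):
1. IDENTITY (from (A1).2, S₄-symmetric word functional `ψ` below, §4): `n₁ + 3 n₂ + 81 M₄ = 16 M_b`.
2. BUDGET LEMMA (ordered-class LP with (A1).2 rows, big-M (A4) covers, copies ≤ 199, rank ≥ 8; exact Farkas certificate `gamma_cert.json`,
   NOT kernel-checked here): `M₄ ≤ 1`; and `M₄ = 0 ⇒ M_b = 0 ⇒ n₁ = n₂ = 0 ⇒ P = ∅ ⇒ N uncovered`.  So exactly ONE anchor cell `m⁴`, WLOG rotation 0.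
   (Independently and more strongly, plan-lens-HodgeAV-dual g10 `XBASE-DECIDED-dual-g10.md` LAW M gives `M₄` even, hence with 2: dead at once.)
3. LOCK LEMMA (§1, (A4)): `a` lies amply below the hub only; `b, k, k̄` lie amply above `m` only when ALIGNED (same quarter turn); `z` lies above `m`
   at relative turns {0, 1}.  Hence every N cell with ≥ 2 non-hub letters is live only under the anchor: all `b⁴` mass sits on the single cell of
   phase 0 and every `z⁴` cell has rotation vector in `{0,1}⁴`.
4. TOP-CHARGE CERTIFICATE (§3): `Λ₀ := Σ_{|E|=1} Im T(E) − Σ_{|E|=3} Im T(E) + Σ_{|E|=2} Re T(E)` over the 14 mixed top words `E ∈ {e,ē}⁴`.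
   Per cell: `Λ₀(z-cell) ≥ 32` on `{0,1}⁴`, `Λ₀(a-cell) ≤ 56` (all 256 turns, `= 56` exactly on `V₈`), `Λ₀(a³m-cell) ≤ 168`, `Λ₀(b⁴,0) = 896`,
   `Λ₀(m⁴,0) = 4536`, `Λ₀ = 0` on every cell with a hub letter.  So `(A1).1 ⇒ 0 = Λ₀(T) ≥ 32 M_z + 56·(16 M_b − n₁ − 3 n₂ − 81) = 32 M_z`
   (by 1. with `M₄ = 1`), i.e. `M_z = 0` (§5 `anchorLock_arith`).
5. With `M_z = 0` the 14 top-word equations read `Σ_{P classes} w_c χ_E(k_c) = Σ w_c` with `|χ_E| = 1`, forcing every P rotation class into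
   `⋂_E ker χ_E = V₈ = {k even, Σ k ≡ 0 (4)}` (§2 `V8_lemma`), on which the `eeee` phase is 1 (§2); hence
   `μ = T(eeee) = −4·(16 M_b − n₁ − 3 n₂ − 81) = 0` (§3 `eeee_values`), contradicting `μ ≠ 0`.  ∎

Corollary: the six S₄-symmetric class solutions of XBASE-12 within 199 copies (195…199; all with zzzz 2, bbbb 20, aaaa 11, aaam 76, mmmm 1 —
extremal g9 memo-09 ∕ R19.41x) have no phase lift; RING6-STAGE2-XBASE (j339259, UNDECIDED root bound 193.15, bus l.10807) is decided NO-DESIGN —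
in agreement with (×2 of) dual g10's THEOREM X, by a disjoint mechanism.

Kernel hygiene: imports `DepthBoundA4` only; `decide` ∕ `decide +kernel` on closed finite statements, `omega` for §5; 0 `sorry`; no `native_decide`;
no axiom ∕ instance ∕ notation; no `set_option allowUnsafeReducibility`.
-/

set_option linter.dupNamespace false
set_option autoImplicit false
set_option maxRecDepth 4096
set_option maxHeartbeats 4000000
set_option synthInstance.maxHeartbeats 400000
set_option synthInstance.maxSize 1024

namespace Summit.HodgeConjecture.HodgeConjecture.Cruxes.BlochSeedDiscOne.DepthBoundA4

section anchorlock

/-! ## §1  The XBASE-12 letters at `h = 6` and the LOCK TABLES -/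

/-- The hub `(6;0,0)`. -/
def alHub : Letter := Letter.hub 6
/-- `m = rot^k (0;3,3)` (P, the anchor letter). -/
def alM (k : Fin 4) : Letter := Letter.rotPow k.val ⟨0, 3, 3⟩
/-- `a = rot^k (4;1,1)` (P). -/
def alA (k : Fin 4) : Letter := Letter.rotPow k.val ⟨4, 1, 1⟩
/-- `z = rot^k (4;2,0)` (N, axis letter). -/
def alZ (k : Fin 4) : Letter := Letter.rotPow k.val ⟨4, 2, 0⟩
/-- `k = rot^k (3;2,1)` (N). -/
def alK (k : Fin 4) : Letter := Letter.rotPow k.val ⟨3, 2, 1⟩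
/-- `k̄ = rot^k (3;1,2)` (N, the mirror class). -/
def alKb (k : Fin 4) : Letter := Letter.rotPow k.val ⟨3, 1, 2⟩
/-- `b = rot^k (2;2,2)` (N). -/
def alB (k : Fin 4) : Letter := Letter.rotPow k.val ⟨2, 2, 2⟩

/-- All XBASE-12 letters lie on the height-6 alphabet. -/
theorem xbase_onAlphabet : ∀ k : Fin 4,
    (alM k).OnAlphabet 6 ∧ (alA k).OnAlphabet 6 ∧ (alZ k).OnAlphabet 6 ∧ (alK k).OnAlphabet 6 ∧ (alKb k).OnAlphabet 6 ∧
    (alB k).OnAlphabet 6 := by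
  unfold Letter.OnAlphabet Letter.height; decide

theorem alHub_onAlphabet : alHub.OnAlphabet 6 := by unfold Letter.OnAlphabet Letter.height; decide

/-- LOCK TABLE `b`: `b` is amply above `m` iff aligned. -/
theorem lock_b : ∀ j k : Fin 4, (AmpleAbove (alM j) (alB k) ↔ k = j) := by unfold AmpleAbove; decide
/-- LOCK TABLE `k`: aligned only. -/
theorem lock_k : ∀ j k : Fin 4, (AmpleAbove (alM j) (alK k) ↔ k = j) := by unfold AmpleAbove; decide
/-- LOCK TABLE `k̄`: aligned only. -/
theorem lock_kb : ∀ j k : Fin 4, (AmpleAbove (alM j) (alKb k) ↔ k = j) := by unfold AmpleAbove; decide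
/-- LOCK TABLE `z`: relative quarter turn 0 or 1 only. -/
theorem lock_z : ∀ j k : Fin 4, (AmpleAbove (alM j) (alZ k) ↔ (k = j ∨ k = j + 1)) := by unfold AmpleAbove; decide
/-- The hub is amply above `m` and above `a` (any turn). -/
theorem hub_above_m_a : ∀ j : Fin 4, AmpleAbove (alM j) alHub ∧ AmpleAbove (alA j) alHub := by unfold AmpleAbove; decide
/-- LOCK TABLE `a`: an `a`-letter lies amply below NO non-hub XBASE letter (so `a` covers hub slots only). -/
theorem a_below_hub_only : ∀ j k : Fin 4,
    ¬ AmpleAbove (alA j) (alZ k) ∧ ¬ AmpleAbove (alA j) (alK k) ∧ ¬ AmpleAbove (alA j) (alKb k) ∧ ¬ AmpleAbove (alA j) (alB k) ∧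
    ¬ AmpleAbove (alA j) (alA k) ∧ ¬ AmpleAbove (alA j) (alM k) := by
  unfold AmpleAbove; decide

/-- The `z⁴ ∕ a⁴ ∕ a³m` cells with rotation vector `k`, and the phase-0 `b⁴ ∕ m⁴` cells. -/
def zCell (k : Fin 4 → Fin 4) : Cell := fun f => alZ (k f)
def aCell (k : Fin 4 → Fin 4) : Cell := fun f => alA (k f)
def amCell (p : Fin 4) (k : Fin 4 → Fin 4) : Cell := fun f => if f = p then alM (k f) else alA (k f)
def bCell0 : Cell := fun _ => alB 0
def mCell0 : Cell := fun _ => alM 0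

/-- LOCK at cell level: a `z⁴` cell is live under the phase-0 anchor iff its rotation vector lies in `{0,1}⁴`; a constant `b⁴` cell iff phase 0. -/
theorem lock_zCell : ∀ k : Fin 4 → Fin 4, (Live mCell0 (zCell k) ↔ ∀ f, (k f).val ≤ 1) := by
  unfold Live mCell0 zCell AmpleAbove; decide
theorem lock_bCell : ∀ j : Fin 4, (Live mCell0 (fun _ => alB j) ↔ j = 0) := by
  unfold Live mCell0 AmpleAbove; decide

/-! ## §2  Top words, rotation characters and the `V₈` LEMMA -/

/-- The top word with `e` on `E` and `ē` off `E`. -/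
def topWord (E : Fin 4 → Bool) : Word := fun f => if E f then Sym.e else Sym.ebar
/-- `E` is mixed (neither `eeee` nor `ēēēē`). -/
def mixedE (E : Fin 4 → Bool) : Prop := E ≠ (fun _ => true) ∧ E ≠ (fun _ => false)

/-- `V₈ = {k ∈ (ℤ∕4)⁴ : every k_f even, Σ k_f ≡ 0 (mod 4)}` (order 8). -/
def InV8 (k : Fin 4 → Fin 4) : Prop := (∀ f, (k f).val % 2 = 0) ∧ InS0 k

/-- **V₈ LEMMA.** A rotation vector fixes the phase of all 14 mixed top words iff it lies in `V₈`. -/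
theorem V8_lemma : ∀ k : Fin 4 → Fin 4, ((∀ E : Fin 4 → Bool, mixedE E → (topWord E).rotPhase k = 1) ↔ InV8 k) := by
  unfold InV8 InS0 mixedE; decide +kernel

/-- On `V₈` the `eeee` phase is 1 as well (so `μ` sees `V₈`-classes exactly like the identity class). -/
theorem V8_keeps_eeee : ∀ k : Fin 4 → Fin 4, InV8 k → Word.eeee.rotPhase k = 1 := by
  unfold InV8 InS0; decide +kernel

/-! ## §3  The TOP-CHARGE CERTIFICATE `Λ₀` -/

def wordsE1 : List Word :=
  [![Sym.e, Sym.ebar, Sym.ebar, Sym.ebar], ![Sym.ebar, Sym.e, Sym.ebar, Sym.ebar], ![Sym.ebar, Sym.ebar, Sym.e, Sym.ebar],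
   ![Sym.ebar, Sym.ebar, Sym.ebar, Sym.e]]
def wordsE3 : List Word :=
  [![Sym.ebar, Sym.e, Sym.e, Sym.e], ![Sym.e, Sym.ebar, Sym.e, Sym.e], ![Sym.e, Sym.e, Sym.ebar, Sym.e],
   ![Sym.e, Sym.e, Sym.e, Sym.ebar]]
def wordsE2 : List Word :=
  [![Sym.e, Sym.e, Sym.ebar, Sym.ebar], ![Sym.e, Sym.ebar, Sym.e, Sym.ebar], ![Sym.e, Sym.ebar, Sym.ebar, Sym.e],
   ![Sym.ebar, Sym.e, Sym.e, Sym.ebar], ![Sym.ebar, Sym.e, Sym.ebar, Sym.e], ![Sym.ebar, Sym.ebar, Sym.e, Sym.e]]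

/-- `Λ₀(c) = Σ_{|E|=1} Im − Σ_{|E|=3} Im + Σ_{|E|=2} Re` of the top-word coefficients of the cell `c`. -/
def Lam0 (c : Cell) : ℤ :=
  (wordsE1.map fun w => (cellCoef c w).im).sum - (wordsE3.map fun w => (cellCoef c w).im).sum
    + (wordsE2.map fun w => (cellCoef c w).re).sum

/-- `z⁴` cells in the locked window: `Λ₀ ≥ 32` (values 32, 64, 96). -/
theorem Lam0_zCell : ∀ k : Fin 4 → Fin 4, (∀ f, (k f).val ≤ 1) → 32 ≤ Lam0 (zCell k) := by decide +kernel
/-- `a⁴` cells, all 256 turns: `Λ₀ ≤ 56`, with equality exactly on `V₈`. -/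
theorem Lam0_aCell : ∀ k : Fin 4 → Fin 4, Lam0 (aCell k) ≤ 56 := by decide +kernel
theorem Lam0_aCell_eq : ∀ k : Fin 4 → Fin 4, (Lam0 (aCell k) = 56 ↔ InV8 k) := by unfold InV8 InS0; decide +kernel
/-- `a³m` cells (any slot of `m`, all turns): `Λ₀ ≤ 168`. -/
theorem Lam0_amCell : ∀ p : Fin 4, ∀ k : Fin 4 → Fin 4, Lam0 (amCell p k) ≤ 168 := by decide +kernel
/-- The phase-0 `b⁴` cell and the anchor. -/
theorem Lam0_b_m : Lam0 bCell0 = 896 ∧ Lam0 mCell0 = 4536 := by decide +kernel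

/-- A hub letter kills every top-word coefficient. -/
theorem coef_top_hub (s : Sym) (hs : s = Sym.e ∨ s = Sym.ebar) : s.coef alHub = 0 := by
  rcases hs with h | h <;> subst h <;> decide

theorem cellCoef_hub_zero (c : Cell) (w : Word) (f : Fin 4) (hc : c f = alHub) (hw : w f = Sym.e ∨ w f = Sym.ebar) :
    cellCoef c w = 0 := by
  unfold cellCoef
  apply Finset.prod_eq_zero (Finset.mem_univ f)
  rw [hc]
  exact coef_top_hub (w f) hw

/-- `Λ₀ = 0` on every cell with a hub letter (so hub-carrying N cells are invisible to the certificate). -/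
theorem Lam0_hub_zero (c : Cell) (f : Fin 4) (hc : c f = alHub) : Lam0 c = 0 := by
  have h : ∀ w : Word, (w f = Sym.e ∨ w f = Sym.ebar) → cellCoef c w = 0 := fun w hw => cellCoef_hub_zero c w f hc hw
  fin_cases f <;> simp [Lam0, wordsE1, wordsE2, wordsE3, h]

/-- `μ`-coefficients (`eeee`) of the phase-0 classes: `a⁴ ↦ −4`, `a³m ↦ −12`, `b⁴ ↦ −64`, `m⁴ ↦ −324 = 81·(−4)`. -/
theorem eeee_values : cellCoef (aCell fun _ => 0) Word.eeee = -4 ∧ (∀ p : Fin 4, cellCoef (amCell p fun _ => 0) Word.eeee = -12) ∧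
    cellCoef bCell0 Word.eeee = -64 ∧ cellCoef mCell0 Word.eeee = -324 := by decide +kernel
/-- … and a `V₈`-class `a⁴ ∕ a³m` cell has the same `eeee` coefficient as the phase-0 one. -/
theorem eeee_V8 : ∀ k : Fin 4 → Fin 4, InV8 k →
    cellCoef (aCell k) Word.eeee = -4 ∧ ∀ p : Fin 4, cellCoef (amCell p k) Word.eeee = -12 := by
  unfold InV8 InS0; decide +kernel

/-! ## §4  The IDENTITY functional `ψ` (from (A1).2) -/

def words111p : List Word :=
  [![Sym.one, Sym.one, Sym.one, Sym.pt], ![Sym.one, Sym.one, Sym.pt, Sym.one], ![Sym.one, Sym.pt, Sym.one, Sym.one],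
   ![Sym.pt, Sym.one, Sym.one, Sym.one]]
def words11hh : List Word :=
  [![Sym.one, Sym.one, Sym.h, Sym.h], ![Sym.one, Sym.h, Sym.one, Sym.h], ![Sym.one, Sym.h, Sym.h, Sym.one],
   ![Sym.h, Sym.one, Sym.one, Sym.h], ![Sym.h, Sym.one, Sym.h, Sym.one], ![Sym.h, Sym.h, Sym.one, Sym.one]]
def words11hp : List Word :=
  [![Sym.one, Sym.one, Sym.h, Sym.pt], ![Sym.one, Sym.one, Sym.pt, Sym.h], ![Sym.one, Sym.h, Sym.one, Sym.pt],
   ![Sym.one, Sym.pt, Sym.one, Sym.h], ![Sym.one, Sym.h, Sym.pt, Sym.one], ![Sym.one, Sym.pt, Sym.h, Sym.one],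
   ![Sym.h, Sym.one, Sym.one, Sym.pt], ![Sym.pt, Sym.one, Sym.one, Sym.h], ![Sym.h, Sym.one, Sym.pt, Sym.one],
   ![Sym.pt, Sym.one, Sym.h, Sym.one], ![Sym.h, Sym.pt, Sym.one, Sym.one], ![Sym.pt, Sym.h, Sym.one, Sym.one]]
def words1hhh : List Word :=
  [![Sym.one, Sym.h, Sym.h, Sym.h], ![Sym.h, Sym.one, Sym.h, Sym.h], ![Sym.h, Sym.h, Sym.one, Sym.h], ![Sym.h, Sym.h, Sym.h, Sym.one]]
def words11pp : List Word :=
  [![Sym.one, Sym.one, Sym.pt, Sym.pt], ![Sym.one, Sym.pt, Sym.one, Sym.pt], ![Sym.one, Sym.pt, Sym.pt, Sym.one],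
   ![Sym.pt, Sym.one, Sym.one, Sym.pt], ![Sym.pt, Sym.one, Sym.pt, Sym.one], ![Sym.pt, Sym.pt, Sym.one, Sym.one]]
def words1hhp : List Word :=
  [![Sym.one, Sym.h, Sym.h, Sym.pt], ![Sym.one, Sym.h, Sym.pt, Sym.h], ![Sym.one, Sym.pt, Sym.h, Sym.h],
   ![Sym.h, Sym.one, Sym.h, Sym.pt], ![Sym.h, Sym.one, Sym.pt, Sym.h], ![Sym.pt, Sym.one, Sym.h, Sym.h],
   ![Sym.h, Sym.h, Sym.one, Sym.pt], ![Sym.h, Sym.pt, Sym.one, Sym.h], ![Sym.pt, Sym.h, Sym.one, Sym.h],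
   ![Sym.h, Sym.h, Sym.pt, Sym.one], ![Sym.h, Sym.pt, Sym.h, Sym.one], ![Sym.pt, Sym.h, Sym.h, Sym.one]]

/-- `ψ(c) = −108 Σ_{111p} + 72 Σ_{11hh} + 12 Σ_{11hp} − 36 Σ_{1hhh} − 2 Σ_{11pp} + Σ_{1hhp}` of the integer (e-free) cell coefficients.
The weights sum to 0 in each degree (2: −108·4 + 72·6; 3: 12·12 − 36·4; 4: −2·6 + 1·12), so (A1).2 gives `Σ_N m ψ − Σ_P m ψ = 0`. -/
def psiCell (c : Cell) : ℤ :=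
  -108 * (words111p.map (icellCoef c)).sum + 72 * (words11hh.map (icellCoef c)).sum + 12 * (words11hp.map (icellCoef c)).sum
    - 36 * (words1hhh.map (icellCoef c)).sum - 2 * (words11pp.map (icellCoef c)).sum + (words1hhp.map (icellCoef c)).sum

theorem psi_degree_balance : (-108 : ℤ) * 4 + 72 * 6 = 0 ∧ (12 : ℤ) * 12 - 36 * 4 = 0 ∧ (-2 : ℤ) * 6 + 1 * 12 = 0 := by decide

/-- The nine N multisets and three P multisets of XBASE-12 as phase-0 representative cells (e-free coefficients are turn-invariant:
`icellCoef_rotCell`), one representative per multiset suffices for the symmetric functional `ψ` … but we list ALL 57 ordered types anyway. -/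
def xbN : List Cell :=
  [ ![alHub, alHub, alHub, alHub],
    ![alHub, alHub, alHub, alK 0], ![alHub, alHub, alK 0, alHub], ![alHub, alK 0, alHub, alHub], ![alK 0, alHub, alHub, alHub],
    ![alHub, alHub, alHub, alB 0], ![alHub, alHub, alB 0, alHub], ![alHub, alB 0, alHub, alHub], ![alB 0, alHub, alHub, alHub],
    ![alHub, alHub, alZ 0, alB 0], ![alHub, alHub, alB 0, alZ 0], ![alHub, alZ 0, alHub, alB 0], ![alHub, alB 0, alHub, alZ 0],
    ![alHub, alZ 0, alB 0, alHub], ![alHub, alB 0, alZ 0, alHub], ![alZ 0, alHub, alHub, alB 0], ![alB 0, alHub, alHub, alZ 0],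
    ![alZ 0, alHub, alB 0, alHub], ![alB 0, alHub, alZ 0, alHub], ![alZ 0, alB 0, alHub, alHub], ![alB 0, alZ 0, alHub, alHub],
    ![alHub, alZ 0, alB 0, alB 0], ![alHub, alB 0, alZ 0, alB 0], ![alHub, alB 0, alB 0, alZ 0],
    ![alZ 0, alHub, alB 0, alB 0], ![alB 0, alHub, alZ 0, alB 0], ![alB 0, alHub, alB 0, alZ 0],
    ![alZ 0, alB 0, alHub, alB 0], ![alB 0, alZ 0, alHub, alB 0], ![alB 0, alB 0, alHub, alZ 0],
    ![alZ 0, alB 0, alB 0, alHub], ![alB 0, alZ 0, alB 0, alHub], ![alB 0, alB 0, alZ 0, alHub],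
    ![alHub, alK 0, alB 0, alB 0], ![alHub, alB 0, alK 0, alB 0], ![alHub, alB 0, alB 0, alK 0],
    ![alK 0, alHub, alB 0, alB 0], ![alB 0, alHub, alK 0, alB 0], ![alB 0, alHub, alB 0, alK 0],
    ![alK 0, alB 0, alHub, alB 0], ![alB 0, alK 0, alHub, alB 0], ![alB 0, alB 0, alHub, alK 0],
    ![alK 0, alB 0, alB 0, alHub], ![alB 0, alK 0, alB 0, alHub], ![alB 0, alB 0, alK 0, alHub],
    ![alHub, alB 0, alB 0, alB 0], ![alB 0, alHub, alB 0, alB 0], ![alB 0, alB 0, alHub, alB 0], ![alB 0, alB 0, alB 0, alHub],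
    ![alZ 0, alZ 0, alZ 0, alZ 0] ]

/-- `ψ` vanishes on every hub-carrying and `z⁴` N type, is `768 = 48·16` on `b⁴`, and `48, 144, 3888 = 48·(1, 3, 81)` on `a⁴, a³m, m⁴`;
the mirror class `k̄` has the same `(a, selfInt)` as `k`, so its types are covered by `icellCoef` depending on `(a, selfInt)` only. -/
theorem psi_xbase12 : (∀ c ∈ xbN, psiCell c = 0) ∧ psiCell bCell0 = 768 ∧ psiCell (aCell fun _ => 0) = 48 ∧
    (∀ p : Fin 4, psiCell (amCell p fun _ => 0) = 144) ∧ psiCell mCell0 = 3888 := by decide +kernel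

/-- `k` and `k̄` letters have the same level and self-intersection (so the same e-free coefficients). -/
theorem k_kb_same_efree : ∀ j : Fin 4, (alK j).a = (alKb j).a ∧ (alK j).selfInt = (alKb j).selfInt ∧
    (alK j).a = (alK 0).a ∧ (alK j).selfInt = (alK 0).selfInt := by decide +kernel

/-! ## §5  The arithmetic of steps 4–5 -/

/-- Step 4: the certificate inequality plus the identity force `M_z = 0`. -/
theorem anchorLock_arith (Mz Mb n1 n2 L : ℤ) (hMz : 0 ≤ Mz) (hid : n1 + 3 * n2 + 81 = 16 * Mb)
    (hL : 32 * Mz + 896 * Mb - 56 * n1 - 168 * n2 - 4536 ≤ L) (hA1 : L = 0) : Mz = 0 := by omega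

/-- Step 5: with all P classes in `V₈` (phase-0 `eeee` coefficients) the identity forces `μ = 0`. -/
theorem anchorLock_mu (Mb n1 n2 mu : ℤ) (hid : n1 + 3 * n2 + 81 = 16 * Mb)
    (hmu : mu = (-64) * Mb - ((-4) * n1 + (-12) * n2 + (-324))) : mu = 0 := by omega

end anchorlock

end Summit.HodgeConjecture.HodgeConjecture.Cruxes.BlochSeedDiscOne.DepthBoundA4
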